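import Literature.NumberTheory.EllipticCurves.NeronComponentIndexTypeIVstarProofs
import Literature.NumberTheory.EllipticCurves.NeronComponentIndexTypeIVExact
import HarnessLib

/-!
# The local index for type `IV*` over a Henselian ring: `c = 3` iff the Step-8 quadratic has a root (proof)

Sequel of `NeronComponentIndexTypeIVstarProofs.lean` (which discharges the named fact
`localTamagawaNumber_of_kodairaSymbolAt_eq_IVstar` in the recorded weak form `c_v ∈ {1, 3}`) and
twin of `NeronComponentIndexTypeIVExact.lean`: the **printed exact alternative** of
Silverman, *ATAEC*, IV.9.4 Step 8 (PDF p. 346): "Type IV*, `m = 7`, `f = v(Δ) − 6`, and `c = 3`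
if `k' = k`, `c = 1` if `k' ≠ k`", `k'` the splitting field of `Y² + a₃,₂Y − a₆,₄` — stated
RELATIVE TO A NORMAL FORM: for an equation `J` over a Henselian discrete valuation ring `R` with
`a₁ ∈ 𝔪`, `a₂ ∈ 𝔪²`, `a₃ = ϖ²γ`, `a₄ ∈ 𝔪³`, `a₆ = ϖ⁴ε` and `γ̄² + 4ε̄ ≠ 0` (the normal form
reached after Steps 2, 6, 8; tree `exists_smul_of_kodairaSymbolOfMinimal_eq_IVstar`), the index
`[E(K) : E₀(K)]` is `3` iff `Y² + γ̄Y − ε̄` has a root in `k`, and `1` otherwise; hence the exact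
value of the local Tamagawa number of an elliptic curve with such a minimal model. Over a
non-Henselian `R` the Hensel-free halves survive (`c ∈ {1,3}`, "`c ≠ 1 ⇒` root").

## Proof

As for type `IV`, two levels deeper: a residual root `r` lifts (Hensel,
`LocalIndex.exists_root_of_residue_root_quadratic`) to `y₁` with `y₁² + γy₁ = ε`, and
`P₀ = (0, ϖ²y₁)` lies on `J` (the equation at `x = 0` is `ϖ⁴(y₁² + γy₁ − ε) = 0`) and reduces to the
singular point, so the index is not `1`, hence `3` (`index_mem_of_normalForm_IVstar`); conversely a
bad point is `(ϖ²x₂, ϖ²y₂)` with `ȳ₂` a root (`exists_eq_some_of_not_hasNonsingularReduction_IVstar`).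
The uniformiser `ϖ` is ANY irreducible element; the tree's Step-8 root count
`distinctRootCount (quadraticStep8 J) = 2` (phrased with `uniformizer R`) is recovered from
`γ̄² + 4ε̄ ≠ 0` through the unit `ϖ / uniformizer R`.

Motivation: BSD rank-`≤ 1` residual cell `b2b-bsdres`, team n1011, row T-MIL-B (stage B of
T-MIL-ODD, `p = 3` entries of the odd part of Milne's quadratic BSD-quotient identity).

## References

* J. H. Silverman, *Advanced Topics in the Arithmetic of Elliptic Curves*, GTM 151, Springer
  1994, Rem. IV.9.3 (PDF p. 341), IV.9.4 Step 8 (PDF p. 346) and its proof (PDF pp. 352–353;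
  Table 4.1: `Φ = ℤ/3ℤ`). [SilvermanATAEC1994]
* J. Tate, *Algorithm for determining the type of a singular fiber in an elliptic pencil*,
  LNM 476 (1975), §7 case 8). [Tate1975]

## Design

Theorems only; no definition, no named fact, no `sorry`; `[HenselianLocalRing R]` only where
Hensel is used.
-/

noncomputable section

open scoped Classical

open IsLocalRing Polynomial

namespace Literature.NumberTheory.EllipticCurves

namespace LocalIndex

open DiophantineGeometry DiophantineGeometry.TateAlgorithm

variable {R : Type*} [CommRing R] [IsDomain R] [IsDiscreteValuationRing R]
  {K : Type*} [Field K] [Algebra R K] [IsFractionRing R K]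

/-- `x ∈ 𝔪ⁿ ↔ ϖⁿ ∣ x` for any irreducible `ϖ` (private helper). [folklore] -/
private theorem mem_maximalIdeal_pow_iff_dvd_of_irreducible {ϖ : R} (hϖ : Irreducible ϖ) (x : R)
    (n : ℕ) : x ∈ maximalIdeal R ^ n ↔ ϖ ^ n ∣ x := by
  rw [hϖ.maximalIdeal_eq, Ideal.span_singleton_pow, Ideal.mem_span_singleton]

/-! ### The bad point `(0, ϖ² y₁)` -/

/-- **A residual root gives a bad point** (type `IV*` normal form, Henselian `R`). If
`a₃ = ϖ²γ`, `a₄ ∈ 𝔪`, `a₆ = ϖ⁴ε`, `Δ ≠ 0`, `γ̄² + 4ε̄ ≠ 0` and `r` is a root of `Y² + γ̄Y − ε̄` in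
`k`, then for a Hensel lift `y₁` of `r` with `y₁² + γy₁ = ε` the point `P₀ = (0, ϖ²y₁)` lies on `J`
(at `x = 0` the equation is `ϖ⁴(y₁² + γy₁ − ε) = 0`) and does NOT have nonsingular reduction.
[cite: SilvermanATAEC1994, IV.9.4 Step 8 (PDF p. 346; proof pp. 352–353)] -/
theorem exists_not_hasNonsingularReduction_of_root_IVstar [HenselianLocalRing R]
    (J : WeierstrassCurve R) {ϖ γ ε : R} (hϖ : Irreducible ϖ) (hγ : J.a₃ = ϖ ^ 2 * γ)
    (h4 : J.a₄ ∈ maximalIdeal R) (hε : J.a₆ = ϖ ^ 4 * ε)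
    (hdisc : residue R γ ^ 2 + 4 * residue R ε ≠ 0) (hΔ : J.Δ ≠ 0) {r : ResidueField R}
    (hr : r ^ 2 + residue R γ * r - residue R ε = 0) :
    ∃ (y₁ : R) (h : (J.baseChange K).toAffine.Nonsingular (algebraMap R K 0)
      (algebraMap R K (ϖ ^ 2 * y₁))),
      residue R y₁ = r ∧ ¬ J.HasNonsingularReduction (.some _ _ h) := by
  obtain ⟨y₁, hy₁, hres⟩ := exists_root_of_residue_root_quadratic hr hdisc
  have hm : ϖ ∈ maximalIdeal R := (IsLocalRing.mem_maximalIdeal _).mpr hϖ.not_isUnit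
  have hm2 : ϖ ^ 2 ∈ maximalIdeal R := Ideal.pow_mem_of_mem _ hm 2 two_pos
  have h3 : J.a₃ ∈ maximalIdeal R := hγ ▸ Ideal.mul_mem_right _ _ hm2
  have heqR : J.toAffine.Equation 0 (ϖ ^ 2 * y₁) := by
    rw [WeierstrassCurve.Affine.equation_iff, hγ, hε]
    linear_combination ϖ ^ 4 * hy₁
  have heq : (J.baseChange K).toAffine.Equation (algebraMap R K 0)
      (algebraMap R K (ϖ ^ 2 * y₁)) :=
    (WeierstrassCurve.Affine.map_equation _ (IsFractionRing.injective R K) _ _).mpr heqR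
  have hΔK : (J.baseChange K).Δ ≠ 0 := by
    simpa only [WeierstrassCurve.baseChange, WeierstrassCurve.map_Δ,
      map_ne_zero_iff _ (IsFractionRing.injective R K)] using hΔ
  have h : (J.baseChange K).toAffine.Nonsingular (algebraMap R K 0)
      (algebraMap R K (ϖ ^ 2 * y₁)) :=
    ((J.baseChange K).toAffine.equation_iff_nonsingular_of_Δ_ne_zero hΔK).mp heq
  exact ⟨y₁, h, hres, not_hasNonsingularReduction_some J h3 h4 (zero_mem _)
    (Ideal.mul_mem_right _ _ hm2) h⟩

/-! ### The exact index for the normal form -/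

/-- The Step-8 root count from the discriminant, for ANY irreducible `ϖ`: with `a₃ = ϖ²γ`,
`a₆ = ϖ⁴ε` and `γ̄² + 4ε̄ ≠ 0`, the tree's `quadraticStep8 J` (normalised by `uniformizer R`) has two
distinct roots (private helper; `ϖ = uniformizer R · u` changes `(γ̄, ε̄)` to `(ū²γ̄, ū⁴ε̄)`).
[folklore] -/
private theorem distinctRootCount_quadraticStep8_eq_two (J : WeierstrassCurve R) {ϖ γ ε : R}
    (hϖ : Irreducible ϖ) (hγ : J.a₃ = ϖ ^ 2 * γ) (hε : J.a₆ = ϖ ^ 4 * ε)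
    (hdisc : residue R γ ^ 2 + 4 * residue R ε ≠ 0) :
    distinctRootCount (quadraticStep8 J) = 2 := by
  obtain ⟨u, hu⟩ := IsDiscreteValuationRing.associated_of_irreducible R irreducible_uniformizer hϖ
  -- `ϖ = uniformizer R * u`
  have hγ' : J.a₃ = uniformizer R ^ 2 * ((u : R) ^ 2 * γ) := by rw [hγ, ← hu]; ring
  have hε' : J.a₆ = uniformizer R ^ 4 * ((u : R) ^ 4 * ε) := by rw [hε, ← hu]; ring
  rw [quadraticStep8_eq hγ' hε']
  unfold distinctRootCount
  refine (card_aroots_toFinset_sq_add_sub_eq_two_iff_ne_zero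
    (L := AlgebraicClosure (ResidueField R)) (residue R ((u : R) ^ 2 * γ))
    (residue R ((u : R) ^ 4 * ε))).mpr ?_
  have hu0 : residue R (u : R) ≠ 0 := (residue_ne_zero_iff_isUnit _).mpr u.isUnit
  intro h0
  apply hdisc
  have e : residue R ((u : R) ^ 2 * γ) ^ 2 + 4 * residue R ((u : R) ^ 4 * ε) =
      residue R (u : R) ^ 4 * (residue R γ ^ 2 + 4 * residue R ε) := by
    simp only [map_mul, map_pow]; ring
  rw [e] at h0
  exact (mul_eq_zero.mp h0).resolve_left (pow_ne_zero 4 hu0)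

/-- **`c ≠ 1 ⇒` the Step-8 quadratic has a root** (no Hensel needed; type `IV*` normal form): a
point outside `E₀(K)` is `(ϖ²x₂, ϖ²y₂)` with `ȳ₂` a root of `Y² + γ̄Y − ε̄`.
[cite: SilvermanATAEC1994, IV.9.4 Step 8 (PDF p. 346; proof pp. 352–353)] -/
theorem exists_root_of_index_ne_one_IVstar (J : WeierstrassCurve R) (h1 : J.a₁ ∈ maximalIdeal R)
    (h2 : J.a₂ ∈ maximalIdeal R ^ 2) {ϖ γ ε : R} (hϖ : Irreducible ϖ) (hγ : J.a₃ = ϖ ^ 2 * γ)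
    (h4 : J.a₄ ∈ maximalIdeal R ^ 3) (hε : J.a₆ = ϖ ^ 4 * ε)
    (hidx : (J.nonsingularReductionSubgroup (integers_valuationRing_valuation R K)).index ≠ 1) :
    ∃ r : ResidueField R, r ^ 2 + residue R γ * r - residue R ε = 0 := by
  have hex : ∃ P : (J.baseChange K).toAffine.Point, ¬ J.HasNonsingularReduction P := by
    by_contra hall
    push Not at hall
    apply hidx
    rw [AddSubgroup.index_eq_one, eq_top_iff]
    exact fun P _ => (WeierstrassCurve.mem_nonsingularReductionSubgroup_iff _).mpr (hall P)
  obtain ⟨P, hP⟩ := hex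
  obtain ⟨α, hα⟩ := (mem_maximalIdeal_iff_dvd_of_irreducible hϖ _).mp h1
  obtain ⟨β, hβ⟩ := (mem_maximalIdeal_pow_iff_dvd_of_irreducible hϖ _ 2).mp h2
  obtain ⟨δ, hδ⟩ := (mem_maximalIdeal_pow_iff_dvd_of_irreducible hϖ _ 3).mp h4
  obtain ⟨x₂, y₂, h, -, hid⟩ :=
    exists_eq_some_of_not_hasNonsingularReduction_IVstar J hϖ hα hβ hγ hδ hε hP
  refine ⟨residue R y₂, ?_⟩
  have := congrArg (residue R) hid
  simpa [residue_uniformizer_eq_zero hϖ] using this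

/-- **Silverman, *ATAEC* IV.9.4 Step 8, exact form (Henselian `R`): `c = 3` iff `k' = k`.** For an
equation `J` over a Henselian discrete valuation ring in the type-`IV*` normal form (`a₁ ∈ 𝔪`,
`a₂ ∈ 𝔪²`, `a₃ = ϖ²γ`, `a₄ ∈ 𝔪³`, `a₆ = ϖ⁴ε`, `γ̄² + 4ε̄ ≠ 0`, `Δ ≠ 0`), the index
`[E(K) : E₀(K)]` equals `3` iff the Step-8 quadratic `Y² + γ̄Y − ε̄` has a root in `k`.
[cite: SilvermanATAEC1994, IV.9.4 Step 8 (PDF p. 346; proof pp. 352–353)] -/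
theorem index_eq_three_iff_exists_root_of_normalForm_IVstar [HenselianLocalRing R]
    (J : WeierstrassCurve R) (h1 : J.a₁ ∈ maximalIdeal R) (h2 : J.a₂ ∈ maximalIdeal R ^ 2)
    {ϖ γ ε : R} (hϖ : Irreducible ϖ) (hγ : J.a₃ = ϖ ^ 2 * γ) (h4 : J.a₄ ∈ maximalIdeal R ^ 3)
    (hε : J.a₆ = ϖ ^ 4 * ε) (hdisc : residue R γ ^ 2 + 4 * residue R ε ≠ 0) (hΔ : J.Δ ≠ 0) :
    (J.nonsingularReductionSubgroup (integers_valuationRing_valuation R K)).index = 3 ↔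
      ∃ r : ResidueField R, r ^ 2 + residue R γ * r - residue R ε = 0 := by
  constructor
  · intro h3
    exact exists_root_of_index_ne_one_IVstar J h1 h2 hϖ hγ h4 hε (by rw [h3]; norm_num)
  · rintro ⟨r, hr⟩
    have hm : ϖ ∈ maximalIdeal R := (IsLocalRing.mem_maximalIdeal _).mpr hϖ.not_isUnit
    have h3 : J.a₃ ∈ maximalIdeal R ^ 2 := hγ ▸ Ideal.mul_mem_right _ _ (Ideal.pow_mem_pow hm 2)
    have h6 : J.a₆ ∈ maximalIdeal R ^ 4 := hε ▸ Ideal.mul_mem_right _ _ (Ideal.pow_mem_pow hm 4)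
    have h8 := distinctRootCount_quadraticStep8_eq_two J hϖ hγ hε hdisc
    obtain ⟨y₁, h, -, hbad⟩ := exists_not_hasNonsingularReduction_of_root_IVstar (K := K) J hϖ
      hγ (Ideal.pow_le_self three_ne_zero h4) hε hdisc hΔ hr
    rcases index_mem_of_normalForm_IVstar (K := K) J h1 h2 h3 h4 h6 h8 with hone | hthree
    · exfalso
      apply hbad
      have htop : J.nonsingularReductionSubgroup (integers_valuationRing_valuation R K) = ⊤ := by
        rwa [AddSubgroup.index_eq_one] at hone
      exact (WeierstrassCurve.mem_nonsingularReductionSubgroup_iff _).mp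
        (htop ▸ AddSubgroup.mem_top _)
    · exact hthree

/-- **`c = 1` iff `k' ≠ k`** (Henselian `R`, type-`IV*` normal form): the index is `1` iff the
Step-8 quadratic has NO root in `k`. [cite: SilvermanATAEC1994, IV.9.4 Step 8 (PDF p. 346)] -/
theorem index_eq_one_iff_forall_not_root_of_normalForm_IVstar [HenselianLocalRing R]
    (J : WeierstrassCurve R) (h1 : J.a₁ ∈ maximalIdeal R) (h2 : J.a₂ ∈ maximalIdeal R ^ 2)
    {ϖ γ ε : R} (hϖ : Irreducible ϖ) (hγ : J.a₃ = ϖ ^ 2 * γ) (h4 : J.a₄ ∈ maximalIdeal R ^ 3)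
    (hε : J.a₆ = ϖ ^ 4 * ε) (hdisc : residue R γ ^ 2 + 4 * residue R ε ≠ 0) (hΔ : J.Δ ≠ 0) :
    (J.nonsingularReductionSubgroup (integers_valuationRing_valuation R K)).index = 1 ↔
      ∀ r : ResidueField R, r ^ 2 + residue R γ * r - residue R ε ≠ 0 := by
  constructor
  · intro hone r hr
    have h3 := (index_eq_three_iff_exists_root_of_normalForm_IVstar (K := K) J h1 h2 hϖ hγ h4 hε
      hdisc hΔ).mpr ⟨r, hr⟩
    omega
  · intro hno
    by_contra hne
    obtain ⟨r, hr⟩ := exists_root_of_index_ne_one_IVstar (K := K) J h1 h2 hϖ hγ h4 hε hne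
    exact hno r hr

/-- **`c = 1` if the Step-8 quadratic has no root in `k`** — the Hensel-free half, valid over ANY
discrete valuation ring (type-`IV*` normal form). [cite: SilvermanATAEC1994, IV.9.4 Step 8 (PDF p. 346)] -/
theorem index_eq_one_of_forall_not_root_of_normalForm_IVstar (J : WeierstrassCurve R)
    (h1 : J.a₁ ∈ maximalIdeal R) (h2 : J.a₂ ∈ maximalIdeal R ^ 2) {ϖ γ ε : R} (hϖ : Irreducible ϖ)
    (hγ : J.a₃ = ϖ ^ 2 * γ) (h4 : J.a₄ ∈ maximalIdeal R ^ 3) (hε : J.a₆ = ϖ ^ 4 * ε)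
    (hno : ∀ r : ResidueField R, r ^ 2 + residue R γ * r - residue R ε ≠ 0) :
    (J.nonsingularReductionSubgroup (integers_valuationRing_valuation R K)).index = 1 := by
  by_contra hne
  obtain ⟨r, hr⟩ := exists_root_of_index_ne_one_IVstar (K := K) J h1 h2 hϖ hγ h4 hε hne
  exact hno r hr

/-! ### The local Tamagawa number of an elliptic curve with a type-`IV*` normal form -/

/-- **Silverman, *ATAEC* IV.9.4 Step 8, exact value of the local Tamagawa number (Henselian
`R`).** Let `W` be an elliptic curve over the fraction field `K` of a Henselian discrete valuation
ring `R` and `J` a minimal `R`-model of `W` (`D • W = J_K`) in the type-`IV*` normal form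
(`a₁ ∈ 𝔪`, `a₂ ∈ 𝔪²`, `a₃ = ϖ²γ`, `a₄ ∈ 𝔪³`, `a₆ = ϖ⁴ε`, `γ̄² + 4ε̄ ≠ 0`). Then `c(W/K) = 3` iff
`Y² + γ̄Y − ε̄` has a root in `k` ("`c = 3` if `k' = k`").
[cite: SilvermanATAEC1994, IV.9.4 Step 8 (PDF p. 346; proof pp. 352–353) with Rem. IV.9.3 (PDF p. 341)] -/
theorem localTamagawaNumber_eq_three_iff_exists_root_of_normalForm_IVstar [HenselianLocalRing R]
    (W : WeierstrassCurve K) [W.IsElliptic] (J : WeierstrassCurve R)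
    (D : WeierstrassCurve.VariableChange K) (hJ : D • W = J.baseChange K)
    [(J.baseChange K).IsMinimal R] (h1 : J.a₁ ∈ maximalIdeal R) (h2 : J.a₂ ∈ maximalIdeal R ^ 2)
    {ϖ γ ε : R} (hϖ : Irreducible ϖ) (hγ : J.a₃ = ϖ ^ 2 * γ) (h4 : J.a₄ ∈ maximalIdeal R ^ 3)
    (hε : J.a₆ = ϖ ^ 4 * ε) (hdisc : residue R γ ^ 2 + 4 * residue R ε ≠ 0) :
    W.localTamagawaNumber R = 3 ↔ ∃ r : ResidueField R, r ^ 2 + residue R γ * r - residue R ε = 0 := by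
  have hΔ : J.Δ ≠ 0 := by
    intro h0
    have : (J.baseChange K).Δ = 0 := by
      simp only [WeierstrassCurve.baseChange, WeierstrassCurve.map_Δ, h0, map_zero]
    rw [← hJ, WeierstrassCurve.variableChange_Δ] at this
    exact mul_ne_zero (pow_ne_zero _ (Units.ne_zero _)) (W.coe_Δ' ▸ W.Δ'.ne_zero) this
  rw [localTamagawaNumber_eq_index_of_smul_eq_baseChange W J D hJ]
  exact index_eq_three_iff_exists_root_of_normalForm_IVstar J h1 h2 hϖ hγ h4 hε hdisc hΔ

/-- **Exact value, the other alternative: `c(W/K) = 1` iff `k' ≠ k`** (Henselian `R`, minimal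
`R`-model in the type-`IV*` normal form). [cite: SilvermanATAEC1994, IV.9.4 Step 8 (PDF p. 346) with Rem. IV.9.3 (PDF p. 341)] -/
theorem localTamagawaNumber_eq_one_iff_forall_not_root_of_normalForm_IVstar [HenselianLocalRing R]
    (W : WeierstrassCurve K) [W.IsElliptic] (J : WeierstrassCurve R)
    (D : WeierstrassCurve.VariableChange K) (hJ : D • W = J.baseChange K)
    [(J.baseChange K).IsMinimal R] (h1 : J.a₁ ∈ maximalIdeal R) (h2 : J.a₂ ∈ maximalIdeal R ^ 2)
    {ϖ γ ε : R} (hϖ : Irreducible ϖ) (hγ : J.a₃ = ϖ ^ 2 * γ) (h4 : J.a₄ ∈ maximalIdeal R ^ 3)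
    (hε : J.a₆ = ϖ ^ 4 * ε) (hdisc : residue R γ ^ 2 + 4 * residue R ε ≠ 0) :
    W.localTamagawaNumber R = 1 ↔ ∀ r : ResidueField R, r ^ 2 + residue R γ * r - residue R ε ≠ 0 := by
  have hΔ : J.Δ ≠ 0 := by
    intro h0
    have : (J.baseChange K).Δ = 0 := by
      simp only [WeierstrassCurve.baseChange, WeierstrassCurve.map_Δ, h0, map_zero]
    rw [← hJ, WeierstrassCurve.variableChange_Δ] at this
    exact mul_ne_zero (pow_ne_zero _ (Units.ne_zero _)) (W.coe_Δ' ▸ W.Δ'.ne_zero) this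
  rw [localTamagawaNumber_eq_index_of_smul_eq_baseChange W J D hJ]
  exact index_eq_one_iff_forall_not_root_of_normalForm_IVstar J h1 h2 hϖ hγ h4 hε hdisc hΔ

end LocalIndex

end Literature.NumberTheory.EllipticCurves

end
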